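import Summits.QuantumFields.BalabanUV.Beta.FP.NestedDressingDress
import Summits.QuantumFields.BalabanUV.Beta.FP.StepLawKHolds

/-!
# `BalabanUV.Beta.FP.NestedDressingSlot` — road «FP» for binder row D1, W-ORACLE-K row **SLOT** (owner d1-p3 gen 15, memo `N2B-DESIGN.md` v3.1 §11 (11a):
# «FIRST ROW (SLOT): `TP (m+1) = hessKer G_N V′ W′`-shape (move the outer dressing from the jets to the resolvent and the column dressing into `vertexOfK`; … the
# m = 1 twin is how the root reads `TbalOf (JsB12Sym …)` through `Gsym`)»), PART 3 of 3: **`hessKer_dressNestAt`** — FOR EVERY DECAYING KERNEL `K`, EVERY JET DATUM `J`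
# (blocking `N`), EVERY DEPTH `M` AND IN-BLOCK ROOT: `hessKer K (vertexOfK K N (dressNestAt … M J).S) (dressNestAt … M J).W = hessKer G (vertexOfK G N J.S) J.W`,
# `G := coDressKNestAt (toSite r) Lc M K = Π̂_{M}·K·Π̂_{M}ᵀ` (= leaf-02's inline `G_nest` pin by `rfl`) — the decl-by-decl twin of an2's `SymmetrisedDressingHessian.hessKer_dressSymAt`
# (K5d §7) with its adjunction ∕ vertex-transfer chain (`SymmetrisedDressingKernel` §decay, `SymmetrisedDressingLinear` §6), `piKSymBm ρ N ↦ piKSymNest ρ Lc M`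

HONEST DEPENDENCY (page 1, mandatory): continuum YM on T⁴ ⇐ BetaPertH ∧ nine spine estimates (0/9 proved); BetaPertH ⇐ (D1) ∧ (D4) ∧ CAP+tail;
G-an2-4 gates asym, D1 and NE2/3/4.  HONEST FRAMING (cell contract, verbatim): «discharging `BetaPertH` makes Bałaban's UV stability UNCONDITIONAL —
a real constructive-QFT result; it is NOT the continuum limit and NOT the Clay problem.»  THIS MODULE DISCHARGES NOTHING of the wall: [folklore] finite window sums, one
Fubini with a product majorant (the windowed adjunction), tame trace cyclicity ∕ associativity (`TameKernelCalculus`); no `def`, no `def … : Prop`, nothing cited, 0 sorry;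
0∕4 row-D1 binders.  It is the SLOT identity for ANY decaying `K` — the road instance (`K := KPerf (m+1)`, `N := Lc^(m+1)`, `M := m+1`, `J :=` the undressed perfect jets of
record) is ONE `exact` for whoever pins those jets (leaf-02 ∕ owner); NOT `G_N = G₁ + G_c` (SPLIT (i)(ii)(iii) are `NestedDressingDefectKill` ∕ `…FineLeg` ∕ `…DescentLeg`),
NOT (SDF), NOT D1, NOT `BetaPertH`, NOT continuum, NOT Clay.  «not in print; our bookkeeping».
SCOPE UNDER E-FP-16-2 ∕ Q-FP-16-6 (owner, journal 2026-08-21T20:30Z): the dressing `Π̂_M = piKSymNest ρ Lc M` is a FIXED lattice kernel (background-independent, `U = 1`);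
NO object of FILES 1–7 ∕ (A)(B)(C) carries the background motion `d/db` of the composite's nested SLICE rows (`τ₂·Q̇₁`).  The identity below is exact for a fixed dressing of
ARBITRARY jets `J`; whether `dressNestAt … (m+1) J` MODELS Bałaban's composite step at `m + 1 ≥ 2` depends on `J` carrying the slice-border jets (R-FP-50's composite tables
«incl. the nested slice rows», or the blindness letters of the toy's variant (iv), or ROUTE T's sliced torus instances) — «modulo R-FP-50 ∕ Q-FP-16-6», asserted NOWHERE here.

ABSOLUTE RULE (cell charter, verbatim): «No internally-minted statement may enter as a cited fact. Every hypothesis is either kernel-proved in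
this package or a verbatim quotation of a PUBLISHED theorem with page reference. The manuscript(s) under audit are NOT citable for their own
disputed steps — they are the thing under adjudication; programme-internal (2001/route/tribunal) claims are never citable.»

CONTENT (generic `d`; window `cube (d+1) (Lc^M)`, blocking `N`, in-block root `r ∈ box (d+1) Lc`, `1 ≤ Lc`): §1 `decays_coDressKNestAt` (= leaf-02's `decays_coDress_piKSymNest`
in `def` form), `spr_coDressKNestAt`; §2 `coProjNestAt_apply` (FILE 7's `coProjNestAt` unfolds), `colH_coDressKNestAt_eq`, **`sum_tsum_mul_coProjNestAtT`** (the windowed adjunction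
`Σ_κ Σ'_u A κ u · (Π̂ᵀ_nest g) κ u = Σ_κ′ Σ'_u′ (coProjNestAt A) κ′ u′ · g κ′ u′`), **`vertexOfK_coProjNestAtK`**, **`vertexOfK_dressNestAt_S`** (the vertex transfer);
§3 **`hessKer_dressNestAt`** (THE SLOT); §4 **`hessKer_dressNestAt_KPerf`** (the road instance, UNCONDITIONAL at `d + 1 = 4`, `Lc ≥ 2`, `n ≥ 1`), `coDressKNestAt_KPerf_eq_Gnest` (`rfl`).
Provenance: road FP swarm LEAF PROVER `b2b-balaban-beta-d1-formalise-leaf-06` gen 15, 2026-08-21, row SLOT (first refusal leaf-06 ∕ an2, owner l.34473 ∕ (11a)); the mathematics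
is an2's (β sub-cell, gen 26), ported by script.  Names PROVISIONAL.
-/

open Finset
open scoped BigOperators
open Literature.MathematicalPhysics.QuantumFieldTheory
open Literature.MathematicalPhysics.QuantumFieldTheory.Balaban1983to89
open Literature.MathematicalPhysics.QuantumFieldTheory.Balaban1983to89.Beta
open B12Sec2to5 (l1 l1_nonneg)
open ExpKernelCalculus (MKer Decays BiLoc comp tr bubble tadpole hessKer VertexFamily VertexFamily₂ shiftK l1_sub_symm)
open AffineAveraging (Form0 Form1 box toSite)
open OneStepResolventKernel (Fib wsum LocStencil JetData)
open OneStepKernelFamily (colH vertexOfK vertexFamily_vertexOfK')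
open Summit.QuantumFields.BalabanUV.Beta.TameKernelCalculus
open Summit.QuantumFields.BalabanUV.Beta.AxialDressingRooted
open Summit.QuantumFields.BalabanUV.Beta.FP.NestedDressingKernel (pmSymNest piKSymNest cPbNest decays_piKSymNest spr_piKSymNest spr_trK_piKSymNest)
open Summit.QuantumFields.BalabanUV.Beta.FP.NestedDressingLinear (coProjNestAt)
open Summit.QuantumFields.BalabanUV.Beta.FP.NestedDressingLegs
open Summit.QuantumFields.BalabanUV.Beta.FP.NestedDressingDress
open Summit.QuantumFields.BalabanUV.Beta.GAN24.CombesThomas (sfStep smStep)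
open Summit.QuantumFields.BalabanUV.Beta.FP.PerfectObjectsT (KPerf)
open Summit.QuantumFields.BalabanUV.Beta.FP.StepLawKHolds (exists_decays_KPerf_holds)

namespace Summit.QuantumFields.BalabanUV.Beta.FP.NestedDressingSlot

noncomputable section

variable {d : ℕ}

/-! ## §1 Decay and spread of the co-dressed kernel -/

section CoDress

/-- [folklore] The co-dressed kernel decays (in-block root). -/
theorem decays_coDressKNestAt {Lc : ℕ} (hLc : 1 ≤ Lc) {r : Fin (d + 1) → ℕ} (hr : r ∈ box (d + 1) Lc) (M : ℕ)
    {K : MKer (d + 1) (Fib d)} (hK : ∃ δ C : ℝ, 0 < δ ∧ 0 ≤ C ∧ Decays K C δ) :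
    ∃ δ C : ℝ, 0 < δ ∧ 0 ≤ C ∧ Decays (coDressKNestAt (toSite r) Lc M K) C δ := by
  obtain ⟨δ, C, hδ, -, hK⟩ := hK
  have hPt : Decays (trK (piKSymNest (toSite r) Lc M)) (cPbNest d Lc M δ) δ := decays_trK (decays_piKSymNest hLc hr M hδ.le)
  have h1 := BalabanStepJetsSucc.decays_comp hPt hK (show 0 ≤ δ / 2 by linarith) (show δ / 2 < δ by linarith)
  have hP : Decays (piKSymNest (toSite r) Lc M) (cPbNest d Lc M (δ / 2)) (δ / 2) := decays_piKSymNest hLc hr M (by linarith)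
  have h2 := BalabanStepJetsSucc.decays_comp h1 hP (show 0 ≤ δ / 4 by linarith) (show δ / 4 < δ / 2 by linarith)
  exact ⟨δ / 4, _, by linarith, h2.nonneg (Sum.inl 0), h2⟩

/-- [folklore] The co-dressed kernel of a spread kernel is spread. -/
theorem spr_coDressKNestAt {Lc : ℕ} (hLc : 1 ≤ Lc) {r : Fin (d + 1) → ℕ} (hr : r ∈ box (d + 1) Lc) (M : ℕ) {K : MKer (d + 1) (Fib d)} (hK : Spr K) :
    Spr (coDressKNestAt (toSite r) Lc M K) :=
  spr_comp (spr_comp (spr_trK_piKSymNest hLc hr M) hK) (spr_piKSymNest hLc hr M)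

end CoDress

/-! ## §2 The windowed adjunction and the vertex transfer -/

section AdjunctionBm

/-- [folklore] `coProjNestAt` unfolds. -/
theorem coProjNestAt_apply (ρ : Fin (d + 1) → ℤ) (Lc M : ℕ) (A : Form1 (d + 1) ℝ) (κ' : Fin (d + 1)) (u' : Fin (d + 1) → ℤ) :
    coProjNestAt ρ Lc M A κ' u' = ∑ v ∈ cube (d + 1) (Lc ^ M), ∑ κ : Fin (d + 1), pmSymNest ρ Lc M κ' u' κ (u' - v) * A κ (u' - v) := rfl

/-- [folklore] The `ℋ`-column of the co-dressed kernel is `coProjNestAt` of the `ℋ`-column (part 4 `colH_coDressKNestAt`). -/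
theorem colH_coDressKNestAt_eq (ρ : Fin (d + 1) → ℤ) (Lc M N : ℕ) (K : MKer (d + 1) (Fib d)) (μ : Fin (d + 1))
    (y : Fin (d + 1) → ℤ) : colH (coDressKNestAt ρ Lc M K) N μ y = coProjNestAt ρ Lc M (colH K N μ y) :=
  funext fun κ' => funext fun u' => colH_coDressKNestAt ρ Lc M N K μ y κ' u'

/-- [folklore] **THE WINDOWED ADJUNCTION** `Σ_κ Σ'_u A κ u · (Π̂ᵀ_nest g) κ u = Σ_κ′ Σ'_u′ (coProjNestAt ρ Lc M A) κ′ u′ · g κ′ u′` for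
summable weights `A` and bounded `g` (in-block root; finite sums out of the series, one lattice shift per window offset). -/
theorem sum_tsum_mul_coProjNestAtT {Lc : ℕ} (hLc : 1 ≤ Lc) {r : Fin (d + 1) → ℕ} (hr : r ∈ box (d + 1) Lc) (M : ℕ)
    {A g : Form1 (d + 1) ℝ} (hA : ∀ κ, Summable (A κ)) {Mg : ℝ} (hg : ∀ κ u, |g κ u| ≤ Mg) :
    ∑ κ : Fin (d + 1), ∑' u, A κ u * coProjNestAtT (toSite r) Lc M g κ u =
      ∑ κ' : Fin (d + 1), ∑' u', coProjNestAt (toSite r) Lc M A κ' u' * g κ' u' := by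
  set B : ℝ := (1 + 4 * ((d : ℝ) + 1) * ((M : ℝ) * (Lc : ℝ) ^ M)) * |Mg| with hB
  -- termwise bound: `|A κ u · pm · g| ≤ |A κ u| · B`
  have hterm : ∀ (κ κ' : Fin (d + 1)) (u w p : Fin (d + 1) → ℤ),
      |A κ u * (pmSymNest (toSite r) Lc M κ' w κ p * g κ' w)| ≤ |A κ u| * B := by
    intro κ κ' u w p
    rw [abs_mul, abs_mul]
    refine mul_le_mul_of_nonneg_left ?_ (abs_nonneg _)
    exact mul_le_mul (abs_pmSymNest_le' hLc hr M κ' w κ p) ((hg κ' w).trans (le_abs_self Mg)) (abs_nonneg _)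
      (by positivity)
  -- summability of the pieces, before and after the shift
  have hs1 : ∀ (κ κ' : Fin (d + 1)) (v : Fin (d + 1) → ℤ),
      Summable fun u => A κ u * (pmSymNest (toSite r) Lc M κ' (u + v) κ u * g κ' (u + v)) := fun κ κ' v =>
    Summable.of_norm_bounded ((hA κ).abs.mul_right B) fun u => by
      rw [Real.norm_eq_abs]; exact hterm κ κ' u (u + v) u
  have hs2 : ∀ (κ κ' : Fin (d + 1)) (v : Fin (d + 1) → ℤ),
      Summable fun u' => A κ (u' - v) * (pmSymNest (toSite r) Lc M κ' u' κ (u' - v) * g κ' u') := fun κ κ' v =>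
    Summable.of_norm_bounded (((Equiv.subRight v).summable_iff.2 (hA κ)).abs.mul_right B) fun u' => by
      rw [Real.norm_eq_abs]; exact hterm κ κ' (u' - v) u' (u' - v)
  -- left side: finite sums out, then shift `u ↦ u′ − v`
  have hL : ∀ κ : Fin (d + 1), ∑' u, A κ u * coProjNestAtT (toSite r) Lc M g κ u =
      ∑ v ∈ cube (d + 1) (Lc ^ M), ∑ κ' : Fin (d + 1), ∑' u', A κ (u' - v) * (pmSymNest (toSite r) Lc M κ' u' κ (u' - v) * g κ' u') := by
    intro κ
    have e1 : (fun u => A κ u * coProjNestAtT (toSite r) Lc M g κ u) = fun u => ∑ v ∈ cube (d + 1) (Lc ^ M), ∑ κ' : Fin (d + 1),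
        A κ u * (pmSymNest (toSite r) Lc M κ' (u + v) κ u * g κ' (u + v)) := by
      funext u
      rw [coProjNestAtT_apply, Finset.mul_sum]
      exact Finset.sum_congr rfl fun v _ => by rw [Finset.mul_sum]
    rw [e1, Summable.tsum_finsetSum (fun v _ => summable_sum fun κ' _ => hs1 κ κ' v)]
    refine Finset.sum_congr rfl fun v _ => ?_
    rw [Summable.tsum_finsetSum (fun κ' _ => hs1 κ κ' v)]
    refine Finset.sum_congr rfl fun κ' _ => ?_
    rw [← KKTFluctuationEnergy.tsum_shift_sub
      (fun u => A κ u * (pmSymNest (toSite r) Lc M κ' (u + v) κ u * g κ' (u + v))) v]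
    exact tsum_congr fun u' => by simp only [sub_add_cancel]
  -- right side: finite sums out
  have hR : ∀ κ' : Fin (d + 1), ∑' u', coProjNestAt (toSite r) Lc M A κ' u' * g κ' u' =
      ∑ v ∈ cube (d + 1) (Lc ^ M), ∑ κ : Fin (d + 1), ∑' u', A κ (u' - v) * (pmSymNest (toSite r) Lc M κ' u' κ (u' - v) * g κ' u') := by
    intro κ'
    have e1 : (fun u' => coProjNestAt (toSite r) Lc M A κ' u' * g κ' u') = fun u' => ∑ v ∈ cube (d + 1) (Lc ^ M), ∑ κ : Fin (d + 1),
        A κ (u' - v) * (pmSymNest (toSite r) Lc M κ' u' κ (u' - v) * g κ' u') := by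
      funext u'
      rw [coProjNestAt_apply, Finset.sum_mul]
      exact Finset.sum_congr rfl fun v _ => by
        rw [Finset.sum_mul]
        exact Finset.sum_congr rfl fun κ _ => by ring
    rw [e1, Summable.tsum_finsetSum (fun v _ => summable_sum fun κ _ => hs2 κ κ' v)]
    exact Finset.sum_congr rfl fun v _ => by rw [Summable.tsum_finsetSum (fun κ _ => hs2 κ κ' v)]
  simp_rw [hL, hR]
  -- both sides are now the same finite triple sum, in different orders
  set T : Fin (d + 1) → (Fin (d + 1) → ℤ) → Fin (d + 1) → ℝ := fun κ v κ' =>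
    ∑' u', A κ (u' - v) * (pmSymNest (toSite r) Lc M κ' u' κ (u' - v) * g κ' u') with hT
  show ∑ κ : Fin (d + 1), ∑ v ∈ cube (d + 1) (Lc ^ M), ∑ κ' : Fin (d + 1), T κ v κ' =
    ∑ κ' : Fin (d + 1), ∑ v ∈ cube (d + 1) (Lc ^ M), ∑ κ : Fin (d + 1), T κ v κ'
  calc ∑ κ : Fin (d + 1), ∑ v ∈ cube (d + 1) (Lc ^ M), ∑ κ' : Fin (d + 1), T κ v κ'
      = ∑ v ∈ cube (d + 1) (Lc ^ M), ∑ κ : Fin (d + 1), ∑ κ' : Fin (d + 1), T κ v κ' := Finset.sum_comm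
    _ = ∑ v ∈ cube (d + 1) (Lc ^ M), ∑ κ' : Fin (d + 1), ∑ κ : Fin (d + 1), T κ v κ' :=
        Finset.sum_congr rfl fun v _ => Finset.sum_comm
    _ = ∑ κ' : Fin (d + 1), ∑ v ∈ cube (d + 1) (Lc ^ M), ∑ κ : Fin (d + 1), T κ v κ' := Finset.sum_comm

/-- [folklore] **THE BOND SLOT THROUGH `K`**: the chain-rule vertex of the `Π̂ᵀ_nest`-dressed bond family is the superposition of
the UNDRESSED stencils with the `coProjNestAt`-image of the `ℋ`-column as weights (decaying `K`, local `S`, in-block root). -/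
theorem vertexOfK_coProjNestAtK {Lc : ℕ} (hLc : 1 ≤ Lc) {r : Fin (d + 1) → ℕ} (hr : r ∈ box (d + 1) Lc) (M : ℕ) {N : ℕ}
    {K : MKer (d + 1) (Fib d)} {C δ : ℝ} (hK : Decays K C δ) (hδK : 0 < δ)
    {S : Fin (d + 1) → (Fin (d + 1) → ℤ) → MKer (d + 1) (Fib d)} {Cs δs : ℝ} (hS : LocStencil S Cs δs) (hδs : 0 ≤ δs)
    (μ : Fin (d + 1)) (y x z : Fin (d + 1) → ℤ) (a b : Fib d) :
    vertexOfK K N (coProjNestAtK (toSite r) Lc M S) μ y x z a b =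
      ∑ κ' : Fin (d + 1), wsum (coProjNestAt (toSite r) Lc M (colH K N μ y) κ') (S κ') x z a b := by
  have hA : ∀ κ : Fin (d + 1), Summable (colH K N μ y κ) :=
    fun κ => AxialDressing.summable_col_of_decays hK hδK ((N : ℤ) • y) (Sum.inl κ) (Sum.inr μ)
  have hg : ∀ (κ : Fin (d + 1)) (u : Fin (d + 1) → ℤ), |(fun κ u => S κ u x z a b) κ u| ≤ Cs := by
    intro κ u
    have h := hS κ u x z a b
    have hCs : 0 ≤ Cs := (hS κ u).nonneg (Sum.inl 0)
    have he : Real.exp (-δs * (l1 (x - u) + l1 (z - u))) ≤ 1 := by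
      rw [Real.exp_le_one_iff]
      have := l1_nonneg (x - u)
      have := l1_nonneg (z - u)
      nlinarith
    calc |S κ u x z a b| ≤ Cs * Real.exp (-δs * (l1 (x - u) + l1 (z - u))) := h
      _ ≤ Cs * 1 := mul_le_mul_of_nonneg_left he hCs
      _ = Cs := mul_one _
  have e1 : vertexOfK K N (coProjNestAtK (toSite r) Lc M S) μ y x z a b =
      ∑ κ' : Fin (d + 1), ∑' u, colH K N μ y κ' u * coProjNestAtT (toSite r) Lc M (fun κ u => S κ u x z a b) κ' u := rfl
  rw [e1, sum_tsum_mul_coProjNestAtT hLc hr M hA hg]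
  rfl

/-- [folklore] **THE VERTEX TRANSFER**: for a decaying `K`, a jet datum `J` and an in-block root,
`vertexOfK K N (dressNestAt hLc hr M J).S μ y = dressKNestAt ρ Lc M (vertexOfK (coDressKNestAt ρ Lc M K) N J.S μ y)` — the chain-rule vertex through `K`
of the nested-dressed stencils is the nested dressing of the vertex through the CO-DRESSED kernel of the undressed stencils. -/
theorem vertexOfK_dressNestAt_S {N : ℕ} {Lc : ℕ} (hLc : 1 ≤ Lc) {r : Fin (d + 1) → ℕ} (hr : r ∈ box (d + 1) Lc) (M : ℕ)
    {K : MKer (d + 1) (Fib d)} {C δ : ℝ} (hK : Decays K C δ) (hδ : 0 < δ) (J : JetData d N) (μ : Fin (d + 1))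
    (y : Fin (d + 1) → ℤ) :
    vertexOfK K N (dressNestAt hLc hr M J).S μ y = dressKNestAt (toSite r) Lc M (vertexOfK (coDressKNestAt (toSite r) Lc M K) N J.S μ y) := by
  have e1 : vertexOfK K N (dressNestAt hLc hr M J).S μ y =
      dressKNestAt (toSite r) Lc M (vertexOfK K N (coProjNestAtK (toSite r) Lc M J.S) μ y) :=
    vertexOfK_dressKNestAt (toSite r) Lc M N hK hδ.le (locStencil_coProjNestAtK hLc hr M J.loc J.δ_pos.le) J.δ_pos μ y
  rw [e1]
  congr 1
  funext x z a b
  rw [vertexOfK_coProjNestAtK hLc hr M hK hδ J.loc J.δ_pos.le, ← colH_coDressKNestAt_eq]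
  rfl

end AdjunctionBm

/-! ## §3 THE SLOT: the dressed-kernel identity for the nested dressing -/

section HessianBm

/-- [folklore] **THE NESTED DRESSING LEMMA OVER AN ARBITRARY DECAYING KERNEL `K`.**  For every decaying `K`, every jet datum `J`
and every in-block root `r`:
`hessKer K (vertexOfK K N (dressNestAt hLc hr M J).S) (dressNestAt hLc hr M J).W = hessKer G (vertexOfK G N J.S) J.W`, `G := coDressKNestAt (toSite r) Lc M K`
(`= Π̂_nest K Π̂ᵀ_nest`).  Tadpole: `tr(K·ΠᵀWΠ) = tr(ΠKΠᵀ·W)`; bubble: `tr(K·ΠᵀV₁Π·K·ΠᵀV₂Π) = tr(G V₁ G V₂)` — tame trace cyclicity and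
associativity (an5's `tr_comp_comm_loc`, `comp_assoc_tame`), every series absolutely convergent. -/
theorem hessKer_dressNestAt {N : ℕ} {Lc : ℕ} (hLc : 1 ≤ Lc) {r : Fin (d + 1) → ℕ} (hr : r ∈ box (d + 1) Lc) (M : ℕ) {K : MKer (d + 1) (Fib d)}
    (hK : ∃ δ C : ℝ, 0 < δ ∧ 0 ≤ C ∧ Decays K C δ) (J : JetData d N) :
    hessKer K (vertexOfK K N (dressNestAt hLc hr M J).S) (dressNestAt hLc hr M J).W =
      hessKer (coDressKNestAt (toSite r) Lc M K) (vertexOfK (coDressKNestAt (toSite r) Lc M K) N J.S) J.W := by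
  obtain ⟨δ, C, hδ, hC, hKd⟩ := hK
  -- the cast
  set P : MKer (d + 1) (Fib d) := piKSymNest (toSite r) Lc M with hPdef
  set G : MKer (d + 1) (Fib d) := coDressKNestAt (toSite r) Lc M K with hGdef
  have sP : Spr P := spr_piKSymNest hLc hr M
  have sPt : Spr (trK P) := spr_trK_piKSymNest hLc hr M
  have sK : Spr K := ⟨C, δ, hδ, hKd⟩
  have sG : Spr G := spr_coDressKNestAt hLc hr M sK
  have sKP : Spr (comp K P) := spr_comp sK sP
  have sPtK : Spr (comp (trK P) K) := spr_comp sPt sK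
  have hGd : ∃ δ C : ℝ, 0 < δ ∧ 0 ≤ C ∧ Decays G C δ := decays_coDressKNestAt hLc hr M ⟨δ, C, hδ, hC, hKd⟩
  obtain ⟨Cv, δv, hδv, hV⟩ := vertexFamily_vertexOfK' (N := N) hGd J.loc J.δ_pos
  have lV : ∀ μ y, Loc (vertexOfK G N J.S μ y) := fun μ y => ⟨_, _, Cv, δv, hδv, hV μ y⟩
  have lW : ∀ μ y ν y', Loc (J.W μ y ν y') := fun μ y ν y' => ⟨_, _, J.Cw, J.δ, J.δ_pos, J.loc₂ μ y ν y'⟩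
  -- G = Pᵀ (K P) (re-association of its definition)
  have hG' : comp (trK P) (comp K P) = G := by
    rw [hGdef, coDressKNestAt_eq, comp_assoc_tame sPt.tame sK.tame sP.tame]
  -- TADPOLE HALF
  have htad : ∀ W : MKer (d + 1) (Fib d), Loc W →
      tadpole K (dressKNestAt (toSite r) Lc M W) = tadpole G W := by
    intro W lW
    have lPW : Loc (comp P W) := sP.comp_loc lW
    have lPWPt : Loc (comp (comp P W) (trK P)) := lPW.comp_spr sPt
    unfold ExpKernelCalculus.tadpole
    rw [show dressKNestAt (toSite r) Lc M W = comp (comp P W) (trK P) from rfl]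
    calc tr (comp K (comp (comp P W) (trK P)))
        = tr (comp (comp (comp P W) (trK P)) K) := (tr_comp_comm_loc lPWPt sK.tame).symm
      _ = tr (comp (comp P W) (comp (trK P) K)) := by rw [← comp_assoc_tame lPW.tame sPt.tame sK.tame]
      _ = tr (comp (comp (trK P) K) (comp P W)) := tr_comp_comm_loc lPW sPtK.tame
      _ = tr (comp (comp (comp (trK P) K) P) W) := by rw [comp_assoc_tame sPtK.tame sP.tame lW.tame]
      _ = tr (comp G W) := by rw [hGdef, coDressKNestAt_eq]
  -- BUBBLE HALF
  have hbub : ∀ V₁ V₂ : MKer (d + 1) (Fib d), Loc V₁ → Loc V₂ →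
      bubble K (dressKNestAt (toSite r) Lc M V₁) (dressKNestAt (toSite r) Lc M V₂) = bubble G V₁ V₂ := by
    intro V₁ V₂ l₁ l₂
    -- step 1: `K (P V Pᵀ) = ((K P) V) Pᵀ`
    have e1 : ∀ V : MKer (d + 1) (Fib d), Loc V → comp K (comp (comp P V) (trK P)) = comp (comp (comp K P) V) (trK P) := by
      intro V lV'
      rw [comp_assoc_tame sK.tame (sP.comp_loc lV').tame sPt.tame, comp_assoc_tame sK.tame sP.tame lV'.tame]
    have lA₁ : Loc (comp (comp K P) V₁) := sKP.comp_loc l₁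
    have lA₂ : Loc (comp (comp K P) V₂) := sKP.comp_loc l₂
    have lA₂Pt : Loc (comp (comp (comp K P) V₂) (trK P)) := lA₂.comp_spr sPt
    have lPtA₂ : Loc (comp (trK P) (comp (comp K P) V₂)) := sPt.comp_loc lA₂
    have lA₁PtA₂ : Loc (comp (comp (comp K P) V₁) (comp (trK P) (comp (comp K P) V₂))) := lA₁.comp lPtA₂
    -- step 3: `Pᵀ ((K P) V) = G V`
    have e3 : ∀ V : MKer (d + 1) (Fib d), Loc V → comp (trK P) (comp (comp K P) V) = comp G V := by
      intro V lV'
      rw [comp_assoc_tame sPt.tame sKP.tame lV'.tame, hG']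
    unfold ExpKernelCalculus.bubble
    rw [show dressKNestAt (toSite r) Lc M V₁ = comp (comp P V₁) (trK P) from rfl,
      show dressKNestAt (toSite r) Lc M V₂ = comp (comp P V₂) (trK P) from rfl, e1 V₁ l₁, e1 V₂ l₂]
    calc tr (comp (comp (comp (comp K P) V₁) (trK P)) (comp (comp (comp K P) V₂) (trK P)))
        = tr (comp (comp (comp K P) V₁) (comp (trK P) (comp (comp (comp K P) V₂) (trK P)))) := by
          rw [← comp_assoc_tame lA₁.tame sPt.tame lA₂Pt.tame]
      _ = tr (comp (comp (comp K P) V₁) (comp (comp (trK P) (comp (comp K P) V₂)) (trK P))) := by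
          rw [comp_assoc_tame sPt.tame lA₂.tame sPt.tame]
      _ = tr (comp (comp (comp (comp K P) V₁) (comp (trK P) (comp (comp K P) V₂))) (trK P)) := by
          rw [comp_assoc_tame lA₁.tame lPtA₂.tame sPt.tame]
      _ = tr (comp (trK P) (comp (comp (comp K P) V₁) (comp (trK P) (comp (comp K P) V₂)))) :=
          tr_comp_comm_loc lA₁PtA₂ sPt.tame
      _ = tr (comp (comp (trK P) (comp (comp K P) V₁)) (comp (trK P) (comp (comp K P) V₂))) := by
          rw [comp_assoc_tame sPt.tame lA₁.tame lPtA₂.tame]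
      _ = tr (comp (comp G V₁) (comp G V₂)) := by rw [e3 V₁ l₁, e3 V₂ l₂]
  -- ASSEMBLY
  funext μ ν z
  show (1 / 2) * tadpole K ((dressNestAt hLc hr M J).W μ 0 ν z) -
      (1 / 2) * bubble K (vertexOfK K N (dressNestAt hLc hr M J).S μ 0) (vertexOfK K N (dressNestAt hLc hr M J).S ν z) =
    (1 / 2) * tadpole G (J.W μ 0 ν z) - (1 / 2) * bubble G (vertexOfK G N J.S μ 0) (vertexOfK G N J.S ν z)
  rw [dressNestAt_W, vertexOfK_dressNestAt_S hLc hr M hKd hδ, vertexOfK_dressNestAt_S hLc hr M hKd hδ, ← hGdef, htad _ (lW μ 0 ν z),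
    hbub _ _ (lV μ 0) (lV ν z)]

end HessianBm

/-! ## §4 The road instance: the perfect `n`-fold resolvent (`d + 1 = 4`, `Lc ≥ 2`) -/

section Road

/-- [our proof] **THE SLOT AT THE PERFECT `n`-FOLD RESOLVENT — UNCONDITIONAL** (`d + 1 = 4`, `Lc ≥ 2`, `n ≥ 1`, any depth `M`, in-block root, road units `sfStep`∕`smStep`;
the decay letter is `StepLawKHolds.exists_decays_KPerf_holds`): for EVERY jet datum `J` at blocking `Lc^n`,
`hessKer (KPerf n) (vertexOfK (KPerf n) (Lc^n) (dressNestAt … M J).S) (dressNestAt … M J).W = hessKer G (vertexOfK G (Lc^n) J.S) J.W`, `G := coDressKNestAt (toSite r) Lc M (KPerf n)`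
(at `M := n` this `G` is leaf-02's G-slot of record `G_nest n`, `PerfectSecondOrderTablesNested`, by `rfl`).  NO jet datum is PINNED here: `J` is universally quantified
(«modulo R-FP-50», owner l.35679: whichever level-`n` jet datum the END adopts — the composite family `S^{(m)}`∕`S₂^{(m)}` of PROPOSED R-FP-50 or any other — instantiates `J`).
Memo §11 (11a) ∕ R-FP-48 SLOT′ (dressing half): `TP (m+1) = hessKer G_N V′ W′` with `V′ := vertexOfK G_N N′ J.S` the moment the END's level-`(m+1)` jets are
`dressNestAt … (m+1) J` of an undressed datum `J`. -/
theorem hessKer_dressNestAt_KPerf {Lc : ℕ} [NeZero Lc] (hLc : 2 ≤ Lc) {r : Fin (3 + 1) → ℕ} (hr : r ∈ box (3 + 1) Lc) {n : ℕ} (hn : 1 ≤ n) (M : ℕ)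
    (J : JetData 3 (Lc ^ n)) :
    hessKer (KPerf (d := 3) Lc (sfStep Lc) (smStep 3 Lc) n)
        (vertexOfK (KPerf (d := 3) Lc (sfStep Lc) (smStep 3 Lc) n) (Lc ^ n) (dressNestAt (show 1 ≤ Lc by omega) hr M J).S)
        (dressNestAt (show 1 ≤ Lc by omega) hr M J).W =
      hessKer (coDressKNestAt (toSite r) Lc M (KPerf (d := 3) Lc (sfStep Lc) (smStep 3 Lc) n))
        (vertexOfK (coDressKNestAt (toSite r) Lc M (KPerf (d := 3) Lc (sfStep Lc) (smStep 3 Lc) n)) (Lc ^ n) J.S) J.W := by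
  obtain ⟨C, δ, hδ, hK⟩ := exists_decays_KPerf_holds hLc hn
  exact hessKer_dressNestAt (by omega) hr M ⟨δ, C, hδ, hK.nonneg (Sum.inl 0), hK⟩ J

/-- [folklore] At `M := n` the co-dressed kernel IS leaf-02's inline G-slot of record `Π^{(n)ᵀ}·KPerf n·Π^{(n)}` (`rfl`). -/
theorem coDressKNestAt_KPerf_eq_Gnest {Lc : ℕ} [NeZero Lc] (r : Fin (3 + 1) → ℕ) (n : ℕ) :
    coDressKNestAt (toSite r) Lc n (KPerf (d := 3) Lc (sfStep Lc) (smStep 3 Lc) n)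
      = comp (comp (trK (piKSymNest (toSite r) Lc n)) (KPerf (d := 3) Lc (sfStep Lc) (smStep 3 Lc) n)) (piKSymNest (toSite r) Lc n) := rfl

end Road

end

end Summit.QuantumFields.BalabanUV.Beta.FP.NestedDressingSlot
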